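import Summits.CriticalPhenomena.CardyFormulaZ2.Theses.CardyBoundaryCoulombGas
import Literature.Probability.Percolation.CornerPercolation
import Literature.Probability.RandomPlanarGeometry.CardyFunctionIncBeta

/-!
# Negative lemmas for the crux `CardyBoundaryCoulombGas.BoundaryDefectGaussianR`, I —
# the mark events partition the crossing event; Fatou cap for the mark-density member

Support file (refuter, cdisprove seat `refuter-cdisprove-stmt-CriticalPhenomena-14132-g2-0`, cycle 2;
everything proved, no `sorry`, no proposition defined, no named fact) for the disproof programme of
the informal rank-2 crux `stmt-CriticalPhenomena-14132` (`BoundaryDefectGaussianR`) of route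
`CardyBoundaryCoulombGas` (work file `Cruxes/BoundaryDefectGaussianR/Disproof.lean`, §9).
Member (i) of the crux — family `(1,1,1;3)` on `ℤ × ℕ`, `w = id`, `δ = 1/n` — concerns the MARK
DENSITY `n · P_{1/2}[(⌊xn⌋,0) is the c-most vertex of [⌊cn⌋,∞) × {0} joined in ℤ × ℕ to
[⌊an⌋,⌊bn⌋] × {0}]` (the sequence of the typed sibling `HalfPlaneMarkDensityLaw`, stmt-5661).
Proved here for bond percolation on `ℤ²` at `p = 1/2`, with no percolation input beyond `P ≤ 1`:

* `disjoint_markEvent`, `biUnion_markEvent`, `sum_real_markEvent_eq`, `riemannSum_markDensity_eq` —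
  EXACT at every mesh: the mark events `E_j = {(j,0) ↔ A} ∖ {[j₀,j) × {0} ↔ A}`, `j₀ ≤ j ≤ J`, are
  pairwise disjoint with union the crossing event `{A ↔ [j₀,J] × {0}}`; the Riemann sum of the mark
  density over `[c, X]` IS the crossing probability `P[[⌊an⌋,⌊bn⌋] ↔ [⌊cn⌋,⌊Xn⌋]]` (the identity
  the route's DensityIntegration step rests on), in particular `≤ 1` (`sum_real_markEvent_le_one`).
* `lintegral_shape_le_one` — Fatou: if the renormalised density converges pointwise to
  `C · Δ(a,b,c)^{1/3}((x-a)(x-b)(x-c))^{-2/3}` then `∫_{(c',X]} C·shape ≤ 1` for all `c < c' ≤ X`.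
The sequel `MarkDensityConstantCap.lean` turns this into the cap `C ≤ cardyConst/3`.
-/

noncomputable section

open Filter Topology Set MeasureTheory
open scoped BigOperators ENNReal

namespace Summit.CriticalPhenomena.CardyFormulaZ2.Theorems.BoundaryDefectGaussianR.Negative

open Literature.Probability.Percolation Literature.Probability.LatticeModels
open Literature.Probability.RandomPlanarGeometry (cardyConst cardyConst_pos crossRatio)

/-- Bond percolation on `ℤ²` at `p = 1/2`. [folklore] -/
abbrev μhalf : Measure (BondConfig (Site 2)) := bondPercolation (zdGraph 2) half
/-- The closed upper half-lattice `ℤ × ℕ`. [folklore] -/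
def halfLattice : Set (Site 2) := {v | 0 ≤ v 1}
/-- The wall point `(⌊tn⌋, 0)`. [folklore] -/
def bpt (t : ℝ) (n : ℕ) : Site 2 := ![⌊t * n⌋, 0]
/-- The wall arc `[⌊an⌋, ⌊bn⌋] × {0}`. [folklore] -/
def barc (a b : ℝ) (n : ℕ) : Set (Site 2) := {v | v 1 = 0 ∧ ⌊a * n⌋ ≤ v 0 ∧ v 0 ≤ ⌊b * n⌋}

/-- The renormalised mark density of member (i) (the sequence of stmt-5661 verbatim). [folklore] -/
def markDensitySeq (a b c x : ℝ) (n : ℕ) : ℝ :=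
  (n : ℝ) * μhalf.real (openCrossing halfLattice (barc a b n) {bpt x n}
      \ openCrossing halfLattice (barc a b n) {v | v 1 = 0 ∧ ⌊c * n⌋ ≤ v 0 ∧ v 0 < ⌊x * n⌋})

/-! ### The cap `C ≤ cardyConst/3` -/

/-- The claimed shape of member (i): `Δ(a,b,c)^{1/3} ((x-a)(x-b)(x-c))^{-2/3}`. [folklore] -/
def shapeFun (a b c x : ℝ) : ℝ :=
  ((b - a) * (c - b) * (c - a)) ^ (1 / 3 : ℝ) * ((x - a) * (x - b) * (x - c)) ^ (-(2 / 3) : ℝ)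


/-- The lattice mark event at integer abscissa `j` with integer threshold `j₀`:
`{(j,0) ↔ A} ∖ {[j₀, j) × {0} ↔ A}` ("`(j,0)` is the `j₀`-most vertex joined to `A`"). [folklore] -/
def markEvent (A : Set (Site 2)) (j₀ j : ℤ) : Set (BondConfig (Site 2)) :=
  openCrossing halfLattice A {![j, 0]}
    \ openCrossing halfLattice A {v | v 1 = 0 ∧ j₀ ≤ v 0 ∧ v 0 < j}

/-- The mark density in terms of `markEvent`. [folklore] -/
theorem markDensitySeq_eq (a b c x : ℝ) (n : ℕ) :
    markDensitySeq a b c x n = (n : ℝ) * μhalf.real (markEvent (barc a b n) ⌊c * n⌋ ⌊x * n⌋) := rfl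

/-- Mark events are measurable (countable vertex set). [folklore] -/
theorem measurableSet_markEvent (A : Set (Site 2)) (j₀ j : ℤ) : MeasurableSet (markEvent A j₀ j) :=
  (measurableSet_openCrossing_of_countable _ _ _).diff (measurableSet_openCrossing_of_countable _ _ _)

/-- Mark events at distinct abscissae `j < j'` above the threshold are disjoint. [folklore] -/
theorem disjoint_markEvent (A : Set (Site 2)) {j₀ j j' : ℤ} (h₀ : j₀ ≤ j) (h : j < j') :
    Disjoint (markEvent A j₀ j) (markEvent A j₀ j') := by
  rw [Set.disjoint_left]
  rintro ω ⟨⟨x, hx, y, hy, hω⟩, -⟩ ⟨-, hω'⟩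
  refine hω' ⟨x, hx, y, ?_, hω⟩
  rw [Set.mem_singleton_iff] at hy
  subst hy
  exact ⟨by simp, by simpa using h₀, by simpa using h⟩

/-- **Exact lattice constraint**: the mark events partition (part of) a crossing event, so their
probabilities over any finite set of abscissae above the threshold sum to at most `1`. [folklore] -/
theorem sum_real_markEvent_le_one (A : Set (Site 2)) (j₀ : ℤ) (S : Finset ℤ) (hS : ∀ j ∈ S, j₀ ≤ j) :
    ∑ j ∈ S, μhalf.real (markEvent A j₀ j) ≤ 1 := by
  rw [← measureReal_biUnion_finset]
  · exact measureReal_le_one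
  · intro j hj j' hj' hne
    rcases lt_or_gt_of_ne hne with h | h
    · exact disjoint_markEvent A (hS j hj) h
    · exact (disjoint_markEvent A (hS j' hj') h).symm
  · exact fun j _ => measurableSet_markEvent A j₀ j

/-- **Exact partition identity** (every mesh): the mark events `E_j`, `j₀ ≤ j ≤ J`, partition the
crossing event `{A ↔ [j₀, J] × {0}}` — "`Σ_x m_δ(x)` IS the crossing probability", the lattice identity
behind the route's DensityIntegration step and behind §9's cap. [folklore] -/
theorem biUnion_markEvent (A : Set (Site 2)) (j₀ J : ℤ) :
    (⋃ j ∈ Finset.Icc j₀ J, markEvent A j₀ j)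
      = openCrossing halfLattice A {v | v 1 = 0 ∧ j₀ ≤ v 0 ∧ v 0 ≤ J} := by
  ext ω
  simp only [Set.mem_iUnion, Finset.mem_Icc, exists_prop]
  constructor
  · rintro ⟨j, ⟨hj₀, hjJ⟩, ⟨x, hx, y, hy, hω⟩, -⟩
    rw [Set.mem_singleton_iff] at hy
    subst hy
    exact ⟨x, hx, _, ⟨by simp, by simpa using hj₀, by simpa using hjJ⟩, hω⟩
  · rintro ⟨x, hx, y, ⟨hy1, hy0, hyJ⟩, hω⟩
    -- the set of good abscissae is nonempty; take its least element
    classical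
    let S : Finset ℤ := (Finset.Icc j₀ J).filter fun j => ω ∈ openCrossing halfLattice A {![j, 0]}
    have hyS : y 0 ∈ S := by
      refine Finset.mem_filter.2 ⟨Finset.mem_Icc.2 ⟨hy0, hyJ⟩, x, hx, ![y 0, 0], rfl, ?_⟩
      have e : y = ![y 0, 0] := by funext j; fin_cases j <;> simp [hy1]
      rwa [← e]
    have hS : S.Nonempty := ⟨_, hyS⟩
    refine ⟨S.min' hS, ?_, ?_⟩
    · have hm := Finset.min'_mem S hS
      exact Finset.mem_Icc.1 (Finset.mem_filter.1 hm).1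
    · refine ⟨(Finset.mem_filter.1 (Finset.min'_mem S hS)).2, ?_⟩
      rintro ⟨x', hx', y', ⟨hy'1, hy'0, hy'lt⟩, hω'⟩
      have hy'S : y' 0 ∈ S := by
        have hmJ : S.min' hS ≤ J := (Finset.mem_Icc.1 (Finset.mem_filter.1 (Finset.min'_mem S hS)).1).2
        refine Finset.mem_filter.2 ⟨Finset.mem_Icc.2 ⟨hy'0, by omega⟩, x', hx', ![y' 0, 0], rfl, ?_⟩
        have e : y' = ![y' 0, 0] := by funext j; fin_cases j <;> simp [hy'1]
        rwa [← e]
      exact absurd (Finset.min'_le S _ hy'S) (not_le.2 hy'lt)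

/-- Hence, exactly: `Σ_{j₀ ≤ j ≤ J} P(E_j) = P[A ↔ [j₀, J] × {0} in ℤ × ℕ]`. [folklore] -/
theorem sum_real_markEvent_eq (A : Set (Site 2)) (j₀ J : ℤ) :
    ∑ j ∈ Finset.Icc j₀ J, μhalf.real (markEvent A j₀ j)
      = μhalf.real (openCrossing halfLattice A {v | v 1 = 0 ∧ j₀ ≤ v 0 ∧ v 0 ≤ J}) := by
  rw [← biUnion_markEvent, measureReal_biUnion_finset]
  · intro j hj j' hj' hne
    rcases lt_or_gt_of_ne hne with h | h
    · exact disjoint_markEvent A (Finset.mem_Icc.1 (Finset.mem_coe.1 hj)).1 h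
    · exact (disjoint_markEvent A (Finset.mem_Icc.1 (Finset.mem_coe.1 hj')).1 h).symm
  · exact fun j _ => measurableSet_markEvent A j₀ j

/-- In the crux's variables: at mesh `1/n`, the Riemann sum of the mark density over the lattice
points of `[c, X]` IS the crossing probability `P[[⌊an⌋,⌊bn⌋] ↔ [⌊cn⌋, ⌊Xn⌋]]` (no error term).
So member (i) + tightness at the lattice scale and at the marks ⇒ half-plane Cardy for these arcs,
and conversely half-plane Cardy pins the constant (cf. `constant_le_of_markDensityShapeWith`). [folklore] -/
theorem riemannSum_markDensity_eq (a b c X : ℝ) (n : ℕ) (hn : 1 ≤ n) :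
    (1 / (n : ℝ)) * ∑ j ∈ Finset.Icc ⌊c * n⌋ ⌊X * n⌋, (n : ℝ) * μhalf.real (markEvent (barc a b n) ⌊c * n⌋ j)
      = μhalf.real (openCrossing halfLattice (barc a b n) {v | v 1 = 0 ∧ ⌊c * n⌋ ≤ v 0 ∧ v 0 ≤ ⌊X * n⌋}) := by
  have hn' : (n : ℝ) ≠ 0 := by exact_mod_cast Nat.one_le_iff_ne_zero.1 hn
  rw [← Finset.mul_sum, ← mul_assoc, one_div_mul_cancel hn', one_mul, sum_real_markEvent_eq]

/-! #### Step B: Fatou — any pointwise limit shape integrates to at most `1` -/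

/-- The renormalised mark density as a step function of the continuum abscissa, cut off to
`(c', X]`, with values in `ℝ≥0∞`. [folklore] -/
def gStep (a b c c' X : ℝ) (n : ℕ) (x : ℝ) : ℝ≥0∞ :=
  (Set.Ioc c' X).indicator (fun x => ENNReal.ofReal (markDensitySeq a b c x n)) x

/-- Measurability in the continuum abscissa (a step function). [folklore] -/
theorem measurable_markDensitySeq (a b c : ℝ) (n : ℕ) :
    Measurable fun x : ℝ => markDensitySeq a b c x n := by
  have h1 : Measurable fun x : ℝ => ⌊x * (n : ℝ)⌋ :=
    Int.measurable_floor.comp (measurable_id.mul_const _)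
  have h2 : Measurable fun j : ℤ => (n : ℝ) * μhalf.real (markEvent (barc a b n) ⌊c * n⌋ j) :=
    measurable_of_countable _
  exact h2.comp h1

/-- Measurability of the cut-off step function. [folklore] -/
theorem measurable_gStep (a b c c' X : ℝ) (n : ℕ) : Measurable (gStep a b c c' X n) :=
  (ENNReal.measurable_ofReal.comp (measurable_markDensitySeq a b c n)).indicator measurableSet_Ioc

/-- Pointwise bound of the step function by a finite sum of indicator functions of the lattice
cells `[j/n, (j+1)/n)`. [folklore] -/
theorem gStep_le_sum (a b c c' X : ℝ) {n : ℕ} (hn : 1 ≤ n) (x : ℝ) :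
    gStep a b c c' X n x ≤
      ∑ j ∈ Finset.Icc ⌊c' * n⌋ ⌊X * n⌋,
        (Set.Ico ((j : ℝ) / n) ((j + 1 : ℝ) / n)).indicator
          (fun _ => ENNReal.ofReal ((n : ℝ) * μhalf.real (markEvent (barc a b n) ⌊c * n⌋ j))) x := by
  unfold gStep
  by_cases hx : x ∈ Set.Ioc c' X
  · rw [Set.indicator_of_mem hx, markDensitySeq_eq]
    have hn' : (0 : ℝ) < n := by exact_mod_cast hn
    set j : ℤ := ⌊x * n⌋ with hj
    have hjmem : j ∈ Finset.Icc ⌊c' * (n : ℝ)⌋ ⌊X * (n : ℝ)⌋ := by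
      rw [Finset.mem_Icc]
      exact ⟨Int.floor_mono (by nlinarith [hx.1]), Int.floor_mono (by nlinarith [hx.2])⟩
    have hxcell : x ∈ Set.Ico ((j : ℝ) / n) ((j + 1 : ℝ) / n) := by
      rw [Set.mem_Ico, div_le_iff₀ hn', lt_div_iff₀ hn']
      exact ⟨Int.floor_le _, Int.lt_floor_add_one _⟩
    refine le_trans (le_of_eq ?_) (Finset.single_le_sum (f := fun (j : ℤ) =>
        (Set.Ico ((j : ℝ) / n) ((j + 1 : ℝ) / n)).indicator
          (fun _ => ENNReal.ofReal ((n : ℝ) * μhalf.real (markEvent (barc a b n) ⌊c * n⌋ j))) x)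
      (fun i _ => zero_le) hjmem)
    rw [Set.indicator_of_mem hxcell]
  · rw [Set.indicator_of_notMem hx]
    exact zero_le

/-- The lattice cells have Lebesgue measure `1/n`. [folklore] -/
theorem volume_cell (j : ℤ) {n : ℕ} (hn : 1 ≤ n) :
    volume (Set.Ico ((j : ℝ) / n) ((j + 1 : ℝ) / n)) = ENNReal.ofReal (1 / n) := by
  rw [Real.volume_Ico]
  congr 1
  have hn' : (n : ℝ) ≠ 0 := by exact_mod_cast (Nat.one_le_iff_ne_zero.1 hn)
  field_simp
  ring

/-- The integral of the step function is at most `1` at every mesh (lattice input: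
`sum_real_markEvent_le_one`). [folklore] -/
theorem lintegral_gStep_le_one (a b c c' X : ℝ) (hcc' : c < c') {n : ℕ} (hn : 1 ≤ n) :
    ∫⁻ x, gStep a b c c' X n x ≤ 1 := by
  have hn' : (0 : ℝ) < n := by exact_mod_cast hn
  calc ∫⁻ x, gStep a b c c' X n x
      ≤ ∫⁻ x, ∑ j ∈ Finset.Icc ⌊c' * n⌋ ⌊X * n⌋,
          (Set.Ico ((j : ℝ) / n) ((j + 1 : ℝ) / n)).indicator
            (fun _ => ENNReal.ofReal ((n : ℝ) * μhalf.real (markEvent (barc a b n) ⌊c * n⌋ j))) x :=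
        lintegral_mono fun x => gStep_le_sum a b c c' X hn x
    _ = ∑ j ∈ Finset.Icc ⌊c' * n⌋ ⌊X * n⌋,
          ENNReal.ofReal ((n : ℝ) * μhalf.real (markEvent (barc a b n) ⌊c * n⌋ j))
            * volume (Set.Ico ((j : ℝ) / n) ((j + 1 : ℝ) / n)) := by
        rw [lintegral_finsetSum]
        · refine Finset.sum_congr rfl fun j _ => ?_
          rw [lintegral_indicator_const measurableSet_Ico]
        · intro j _
          exact measurable_const.indicator measurableSet_Ico
    _ = ∑ j ∈ Finset.Icc ⌊c' * n⌋ ⌊X * n⌋,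
          ENNReal.ofReal (μhalf.real (markEvent (barc a b n) ⌊c * n⌋ j)) := by
        refine Finset.sum_congr rfl fun j _ => ?_
        rw [volume_cell j hn, ← ENNReal.ofReal_mul (by positivity)]
        congr 1
        field_simp
    _ = ENNReal.ofReal (∑ j ∈ Finset.Icc ⌊c' * n⌋ ⌊X * n⌋,
          μhalf.real (markEvent (barc a b n) ⌊c * n⌋ j)) :=
        (ENNReal.ofReal_sum_of_nonneg fun j _ => measureReal_nonneg).symm
    _ ≤ ENNReal.ofReal 1 := by
        refine ENNReal.ofReal_le_ofReal (sum_real_markEvent_le_one _ _ _ fun j hj => ?_)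
        rw [Finset.mem_Icc] at hj
        exact (Int.floor_mono (by nlinarith)).trans hj.1
    _ = 1 := ENNReal.ofReal_one

/-- **Fatou cap (lintegral form).** If member (i) holds with constant `C` then for all
`a < b < c < c' ≤ X`: `∫_{(c',X]} C · shape ≤ 1`. [folklore] -/
theorem lintegral_shape_le_one {C : ℝ}
    (h : ∀ a b c x : ℝ, a < b → b < c → c < x →
      Tendsto (markDensitySeq a b c x) atTop (𝓝 (C * shapeFun a b c x))) {a b c c' X : ℝ}
    (hab : a < b) (hbc : b < c) (hcc' : c < c') :
    ∫⁻ x in Set.Ioc c' X, ENNReal.ofReal (C * shapeFun a b c x) ≤ 1 := by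
  have hlim : ∀ x, Tendsto (fun n => gStep a b c c' X n x) atTop
      (𝓝 ((Set.Ioc c' X).indicator (fun x => ENNReal.ofReal (C * shapeFun a b c x)) x)) := by
    intro x
    by_cases hx : x ∈ Set.Ioc c' X
    · simp only [gStep, Set.indicator_of_mem hx]
      exact (ENNReal.continuous_ofReal.tendsto _).comp (h a b c x hab hbc (hcc'.trans hx.1))
    · simp only [gStep, Set.indicator_of_notMem hx]
      exact tendsto_const_nhds
  have hfatou := lintegral_liminf_le (μ := volume) (u := atTop) (f := fun n => gStep a b c c' X n)
    (fun n => measurable_gStep a b c c' X n)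
  have hleft : ∫⁻ x, liminf (fun n => gStep a b c c' X n x) atTop
      = ∫⁻ x in Set.Ioc c' X, ENNReal.ofReal (C * shapeFun a b c x) := by
    rw [← lintegral_indicator measurableSet_Ioc]
    refine lintegral_congr fun x => ?_
    exact (hlim x).liminf_eq
  rw [← hleft]
  refine hfatou.trans ?_
  refine liminf_le_of_frequently_le (Eventually.frequently ?_)
  filter_upwards [eventually_ge_atTop 1] with n hn
  exact lintegral_gStep_le_one a b c c' X hcc' hn


end Summit.CriticalPhenomena.CardyFormulaZ2.Theorems.BoundaryDefectGaussianR.Negative
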